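import Summits.AtomisticToContinuum.HydrodynamicLimit.Theorems.JParityClosureLocalSecondLawLedgerIBP
import Summits.AtomisticToContinuum.HydrodynamicLimit.Theorems.JParityClosureLocalSecondLawLedgerPointwise

/-!
# Entropy ledger for `JParityClosure.LocalSecondLaw` — the integrated Gibbs identity at a regular configuration
(stmt-AtomisticToContinuum-13081, line `exact-entropy-ledger-three-passivities`, layer 6 of stub L)

For a configuration in the regular range and a `C¹` weight `g` on `𝕋³`, all integrands of the ledger at this
configuration are honest (bounded and measurable: continuous factors times crux partial derivatives of
Lipschitz fields), the total derivatives `∂ₖ(g S u_k)` and `∂ₖ((g/θ) q_k)` have zero mean (layer 4), and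
integrating the pointwise Gibbs identity (layer 5) over the torus gives
`∫ g ∂ₜS = ∫ S u·∇g + ∫ (g/θ) Σ^dev:∇u - ∫ (g/θ) p_ex div u - ∫ ∇(g/θ)·q^kin`
(`integral_mul_dSfl`), together with the integrability of `g ∂ₜS`.

References: S. R. de Groot, P. Mazur, *Non-Equilibrium Thermodynamics* (1962) Ch. II §2.
-/

noncomputable section

namespace Summit.AtomisticToContinuum.HydrodynamicLimit.Theorems.LocalSecondLawLedger

open scoped BigOperators Topology ENNReal InnerProductSpace
open Filter Set MeasureTheory
open Literature.MathematicalPhysics.KineticTheory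
open Literature.Analysis.FluidPDE
open Literature.Analysis.FunctionSpaces
open Summit.AtomisticToContinuum.HydrodynamicLimit.Theorems.LocalSecondLawNegative

namespace L

variable {N : ℕ}

/-! ## Continuity of the coarse fields of a regular configuration -/

section Regular

variable {σ r c η₁ η₀ : ℝ} {F : ℝ → ℝ} (hE : EosBand η₀ F) (hη₁ : η₁ < η₀) (hσ : 0 < σ) (hr : 0 < r) (hc : 0 < c)
  (w : Phase N) (hreg : ∀ x, c ≤ rhoC r w x ∧ rhoC r w x * σ ^ 3 ≤ η₁ ∧ c ≤ thetaC r w x)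

include hr in
/-- The mollified density is continuous. [folklore] -/
theorem continuous_rhoC : Continuous (rhoC r w) :=
  (exists_lipschitzWith_rhoC hr w).elim fun _ h => h.continuous

include hr in
/-- The mollified momentum components are continuous. [folklore] -/
theorem continuous_momC_apply (l : Fin 3) : Continuous fun x => momC r w x l :=
  (exists_lipschitzWith_momC hr w l).elim fun _ h => h.continuous

include hr in
/-- The second moment is continuous. [folklore] -/
theorem continuous_Mmom (k l : Fin 3) : Continuous fun x => Mmom r w x k l :=
  (exists_lipschitzWith_Mmom hr w k l).elim fun _ h => h.continuous

include hr hc hreg in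
/-- In the regular range the coarse temperature is continuous. [folklore] -/
theorem continuous_thetaC : Continuous (thetaC r w) :=
  (exists_lipschitzWith_thetaC hr w hc hreg).elim fun _ h => h.continuous

include hr hc hreg in
/-- In the regular range the coarse velocity components are continuous. [folklore] -/
theorem continuous_uC_apply (l : Fin 3) : Continuous fun x => uC r w x l :=
  (exists_lipschitzWith_uC hr w hc hreg l).elim fun _ h => h.continuous

include hr hc hreg in
/-- In the regular range the kinetic heat current is continuous. [folklore] -/
theorem continuous_qkinC_apply (k : Fin 3) : Continuous fun x => qkinC r w x k :=
  (exists_lipschitzWith_qkinC hr w hc hreg k).elim fun _ h => h.continuous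

include hE hη₁ hσ hr hc hreg in
/-- In the regular range the entropy density field is continuous. [folklore] -/
theorem continuous_Hs_comp : Continuous fun x => Hs σ (rhoC r w x) (thetaC r w x) :=
  (exists_lipschitzWith_Hs hr w hc hreg hE hη₁ hσ).elim fun _ h => h.continuous

include hr hc hreg in
/-- In the regular range the traceless stress is continuous. [folklore] -/
theorem continuous_devC (k l : Fin 3) : Continuous fun x => devC r w x k l := by
  have hfun : (fun x => devC r w x k l) = fun x => Mmom r w x k l - uC r w x k * momC r w x l
      - momC r w x k * uC r w x l + rhoC r w x * uC r w x k * uC r w x l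
      - rhoC r w x * thetaC r w x * (if k = l then 1 else 0) := funext fun x => devC_eq r w x k l
  rw [hfun]
  have hρ := continuous_rhoC hr w
  have hu := continuous_uC_apply hr hc w hreg
  have hm := continuous_momC_apply hr w
  exact ((((continuous_Mmom hr w k l).sub ((hu k).mul (hm l))).sub ((hm k).mul (hu l))).add
    ((hρ.mul (hu k)).mul (hu l))).sub ((hρ.mul (continuous_thetaC hr hc w hreg)).mul continuous_const)

include hE hη₁ hσ hr hc hreg in
/-- In the regular range the excess pressure is continuous (the derivative of the excess free energy is
continuous inside the band). [folklore] -/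
theorem continuous_pexC : Continuous (pexC σ r w) := by
  have hρ := continuous_rhoC hr w
  have hθ := continuous_thetaC hr hc w hreg
  have hf : Continuous fun x => deriv hsExcessFreeEnergy (rhoC r w x * σ ^ 3) := by
    refine (EosBand.continuousOn_deriv hE).comp_continuous (hρ.mul continuous_const) fun x => ?_
    exact ⟨mul_pos (hc.trans_le (hreg x).1) (pow_pos hσ 3), (hreg x).2.1.trans_lt hη₁⟩
  unfold pexC hsPressure hsCompressibility
  exact ((hρ.mul hθ).mul (continuous_const.add ((hρ.mul continuous_const).mul hf))).sub (hρ.mul hθ)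

/-! ## Honest integrands and the integrated Gibbs identity -/

variable {g : T3 → ℝ} (hg : Torus.IsContDiff 1 g)

include hE hη₁ hσ hr hc hreg hg in
/-- `g S u_k` is Lipschitz in the regular range. [folklore] -/
theorem exists_lipschitzWith_gSu (k : Fin 3) :
    ∃ K, LipschitzWith K fun y => g y * Hs σ (rhoC r w y) (thetaC r w y) * uC r w y k := by
  obtain ⟨Kg, hKg⟩ := exists_lipschitzWith_of_isContDiff hg
  obtain ⟨KS, hKS⟩ := exists_lipschitzWith_Hs hr w hc hreg hE hη₁ hσ
  obtain ⟨Ku, hKu⟩ := exists_lipschitzWith_uC hr w hc hreg k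
  obtain ⟨A, hA⟩ := exists_abs_le_of_lipschitzWith hKg
  obtain ⟨B, hB⟩ := exists_abs_le_of_lipschitzWith hKS
  have h1 := lipschitzWith_mul_bounded hKg hKS hA hB
  obtain ⟨C, hC⟩ := exists_abs_le_of_lipschitzWith h1
  obtain ⟨D, hD⟩ := exists_abs_le_of_lipschitzWith hKu
  exact ⟨_, lipschitzWith_mul_bounded h1 hKu hC hD⟩

include hr hc hreg hg in
/-- `g / θ` is Lipschitz in the regular range. [folklore] -/
theorem exists_lipschitzWith_g_div_thetaC : ∃ K, LipschitzWith K fun y => g y / thetaC r w y := by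
  obtain ⟨Kg, hKg⟩ := exists_lipschitzWith_of_isContDiff hg
  obtain ⟨Kθ, hKθ⟩ := exists_lipschitzWith_inv_thetaC hr w hc hreg
  obtain ⟨A, hA⟩ := exists_abs_le_of_lipschitzWith hKg
  obtain ⟨B, hB⟩ := exists_abs_le_of_lipschitzWith hKθ
  have h := lipschitzWith_mul_bounded hKg hKθ hA hB
  exact ⟨_, by simpa only [div_eq_mul_inv] using h⟩

include hr hc hreg hg in
/-- `(g/θ) q_k` is Lipschitz in the regular range. [folklore] -/
theorem exists_lipschitzWith_gq (k : Fin 3) :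
    ∃ K, LipschitzWith K fun y => g y / thetaC r w y * qkinC r w y k := by
  obtain ⟨K₁, h₁⟩ := exists_lipschitzWith_g_div_thetaC hr hc w hreg hg
  obtain ⟨K₂, h₂⟩ := exists_lipschitzWith_qkinC hr w hc hreg k
  obtain ⟨A, hA⟩ := exists_abs_le_of_lipschitzWith h₁
  obtain ⟨B, hB⟩ := exists_abs_le_of_lipschitzWith h₂
  exact ⟨_, lipschitzWith_mul_bounded h₁ h₂ hA hB⟩

include hE hη₁ hσ hr hc hreg hg in
/-- **The integrated Gibbs identity at a regular configuration** and the integrability of `g ∂ₜS`: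
`∫ g ∂ₜS = ∫ S ∑ₖ (mₖ/ρ) ∂ₖg + ∫ (g/θ) ∑ₖₗ Σ^dev_{kl} ∂ₖu_l - ∫ (g/θ) p_ex ∑ₖ ∂ₖu_k - ∫ ∑ₖ ∂ₖ(g/θ) q_k`.
[folklore] -/
theorem integral_mul_dSfl :
    Integrable (fun x => g x * dSfl σ r w x) ∧
    ∫ x, g x * dSfl σ r w x =
      (∫ x, Hs σ (rhoC r w x) (thetaC r w x) * ∑ k, momC r w x k / rhoC r w x * pD k g x)
      + (∫ x, g x / thetaC r w x * ∑ k, ∑ l, devC r w x k l * pD k (fun y => uC r w y l) x)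
      - (∫ x, g x / thetaC r w x * pexC σ r w x * ∑ k, pD k (fun y => uC r w y k) x)
      - ∫ x, ∑ k, pD k (fun y => g y / thetaC r w y) x * qkinC r w x k := by
  -- the six honest integrands
  have hLA := fun k => exists_lipschitzWith_gSu hE hη₁ hσ hr hc w hreg hg k
  choose KA hKA using hLA
  have hLE := fun k => exists_lipschitzWith_gq hr hc w hreg hg k
  choose KE hKE using hLE
  obtain ⟨Kg, hKg⟩ := exists_lipschitzWith_of_isContDiff hg
  have hLu := fun l => exists_lipschitzWith_uC hr w hc hreg l
  choose Ku hKu using hLu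
  obtain ⟨Kq, hKq⟩ := exists_lipschitzWith_g_div_thetaC hr hc w hreg hg
  have hgc : Continuous g := hKg.continuous
  have hρc := continuous_rhoC hr w
  have hθc := continuous_thetaC hr hc w hreg
  have hSc := continuous_Hs_comp hE hη₁ hσ hr hc w hreg
  have huc := continuous_uC_apply hr hc w hreg
  have hqc := continuous_qkinC_apply hr hc w hreg
  have hgθc : Continuous fun x => g x / thetaC r w x := hKq.continuous
  have hIA : ∀ k, Integrable fun x => pD k (fun y => g y * Hs σ (rhoC r w y) (thetaC r w y) * uC r w y k) x :=
    fun k => integrable_of_abs_le (measurable_pD k (hKA k).continuous).aestronglyMeasurable (abs_pD_le (hKA k) k)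
  have hIB : Integrable fun x => Hs σ (rhoC r w x) (thetaC r w x) * ∑ k, momC r w x k / rhoC r w x * pD k g x := by
    have : (fun x => Hs σ (rhoC r w x) (thetaC r w x) * ∑ k, momC r w x k / rhoC r w x * pD k g x) =
        fun x => ∑ k, (Hs σ (rhoC r w x) (thetaC r w x) * (momC r w x k / rhoC r w x)) * pD k g x := by
      funext x; rw [Finset.mul_sum]; refine Finset.sum_congr rfl fun k _ => ?_; ring
    rw [this]
    refine integrable_finsetSum _ fun k _ => ?_
    exact integrable_continuous_mul (hSc.mul ((continuous_momC_apply hr w k).div hρc fun x =>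
      (hc.trans_le (hreg x).1).ne')) (measurable_pD k hgc) (abs_pD_le hKg k)
  have hIC : Integrable fun x => g x / thetaC r w x * ∑ k, ∑ l, devC r w x k l * pD k (fun y => uC r w y l) x := by
    have : (fun x => g x / thetaC r w x * ∑ k, ∑ l, devC r w x k l * pD k (fun y => uC r w y l) x) =
        fun x => ∑ k, ∑ l, (g x / thetaC r w x * devC r w x k l) * pD k (fun y => uC r w y l) x := by
      funext x; rw [Finset.mul_sum]; refine Finset.sum_congr rfl fun k _ => ?_
      rw [Finset.mul_sum]; refine Finset.sum_congr rfl fun l _ => ?_; ring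
    rw [this]
    refine integrable_finsetSum _ fun k _ => integrable_finsetSum _ fun l _ => ?_
    exact integrable_continuous_mul (hgθc.mul (continuous_devC hr hc w hreg k l)) (measurable_pD k (huc l))
      (abs_pD_le (hKu l) k)
  have hID : Integrable fun x => g x / thetaC r w x * pexC σ r w x * ∑ k, pD k (fun y => uC r w y k) x := by
    have : (fun x => g x / thetaC r w x * pexC σ r w x * ∑ k, pD k (fun y => uC r w y k) x) =
        fun x => ∑ k, (g x / thetaC r w x * pexC σ r w x) * pD k (fun y => uC r w y k) x := by
      funext x; rw [Finset.mul_sum]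
    rw [this]
    refine integrable_finsetSum _ fun k _ => ?_
    exact integrable_continuous_mul (hgθc.mul (continuous_pexC hE hη₁ hσ hr hc w hreg)) (measurable_pD k (huc k))
      (abs_pD_le (hKu k) k)
  have hIE : ∀ k, Integrable fun x => pD k (fun y => g y / thetaC r w y * qkinC r w y k) x :=
    fun k => integrable_of_abs_le (measurable_pD k (hKE k).continuous).aestronglyMeasurable (abs_pD_le (hKE k) k)
  have hIF : Integrable fun x => ∑ k, pD k (fun y => g y / thetaC r w y) x * qkinC r w x k := by
    refine integrable_finsetSum _ fun k _ => ?_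
    have : (fun x => pD k (fun y => g y / thetaC r w y) x * qkinC r w x k) =
        fun x => qkinC r w x k * pD k (fun y => g y / thetaC r w y) x := funext fun x => mul_comm _ _
    rw [this]
    exact integrable_continuous_mul (hqc k) (measurable_pD k hgθc) (abs_pD_le hKq k)
  -- the pointwise identity, almost everywhere
  have hae : ∀ᵐ x : T3, g x * dSfl σ r w x =
      -(∑ k, pD k (fun y => g y * Hs σ (rhoC r w y) (thetaC r w y) * uC r w y k) x)
        + Hs σ (rhoC r w x) (thetaC r w x) * ∑ k, momC r w x k / rhoC r w x * pD k g x
        + g x / thetaC r w x * ∑ k, ∑ l, devC r w x k l * pD k (fun y => uC r w y l) x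
        - g x / thetaC r w x * pexC σ r w x * ∑ k, pD k (fun y => uC r w y k) x
        + (∑ k, pD k (fun y => g y / thetaC r w y * qkinC r w y k) x)
        - ∑ k, pD k (fun y => g y / thetaC r w y) x * qkinC r w x k := by
    filter_upwards [ae_differentiableAt_cone hr w] with x hx
    exact pointwise_gibbs hE hη₁ hσ hc hreg hg hx
  have hI1 : Integrable (fun x => -(∑ k, pD k (fun y => g y * Hs σ (rhoC r w y) (thetaC r w y) * uC r w y k) x)) :=
    (integrable_finsetSum _ fun k _ => hIA k).neg
  have hI12 : Integrable (fun x =>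
      -(∑ k, pD k (fun y => g y * Hs σ (rhoC r w y) (thetaC r w y) * uC r w y k) x)
        + Hs σ (rhoC r w x) (thetaC r w x) * ∑ k, momC r w x k / rhoC r w x * pD k g x) := hI1.add hIB
  have hI123 : Integrable (fun x =>
      -(∑ k, pD k (fun y => g y * Hs σ (rhoC r w y) (thetaC r w y) * uC r w y k) x)
        + Hs σ (rhoC r w x) (thetaC r w x) * ∑ k, momC r w x k / rhoC r w x * pD k g x
        + g x / thetaC r w x * ∑ k, ∑ l, devC r w x k l * pD k (fun y => uC r w y l) x) := hI12.add hIC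
  have hI1234 : Integrable (fun x =>
      -(∑ k, pD k (fun y => g y * Hs σ (rhoC r w y) (thetaC r w y) * uC r w y k) x)
        + Hs σ (rhoC r w x) (thetaC r w x) * ∑ k, momC r w x k / rhoC r w x * pD k g x
        + g x / thetaC r w x * ∑ k, ∑ l, devC r w x k l * pD k (fun y => uC r w y l) x
        - g x / thetaC r w x * pexC σ r w x * ∑ k, pD k (fun y => uC r w y k) x) := hI123.sub hID
  have hI5 : Integrable (fun x => ∑ k, pD k (fun y => g y / thetaC r w y * qkinC r w y k) x) :=
    integrable_finsetSum _ fun k _ => hIE k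
  have hI12345 : Integrable (fun x =>
      -(∑ k, pD k (fun y => g y * Hs σ (rhoC r w y) (thetaC r w y) * uC r w y k) x)
        + Hs σ (rhoC r w x) (thetaC r w x) * ∑ k, momC r w x k / rhoC r w x * pD k g x
        + g x / thetaC r w x * ∑ k, ∑ l, devC r w x k l * pD k (fun y => uC r w y l) x
        - g x / thetaC r w x * pexC σ r w x * ∑ k, pD k (fun y => uC r w y k) x
        + (∑ k, pD k (fun y => g y / thetaC r w y * qkinC r w y k) x)) := hI1234.add hI5
  have hIrhs : Integrable (fun x =>
      -(∑ k, pD k (fun y => g y * Hs σ (rhoC r w y) (thetaC r w y) * uC r w y k) x)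
        + Hs σ (rhoC r w x) (thetaC r w x) * ∑ k, momC r w x k / rhoC r w x * pD k g x
        + g x / thetaC r w x * ∑ k, ∑ l, devC r w x k l * pD k (fun y => uC r w y l) x
        - g x / thetaC r w x * pexC σ r w x * ∑ k, pD k (fun y => uC r w y k) x
        + (∑ k, pD k (fun y => g y / thetaC r w y * qkinC r w y k) x)
        - ∑ k, pD k (fun y => g y / thetaC r w y) x * qkinC r w x k) := hI12345.sub hIF
  refine ⟨hIrhs.congr (Filter.EventuallyEq.symm hae), ?_⟩
  rw [integral_congr_ae hae, integral_sub hI12345 hIF, integral_add hI1234 hI5, integral_sub hI123 hID,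
    integral_add hI12 hIC, integral_add hI1 hIB, integral_neg, integral_finsetSum _ (fun k _ => hIA k),
    integral_finsetSum _ (fun k _ => hIE k)]
  have h0A : ∀ k, ∫ x, pD k (fun y => g y * Hs σ (rhoC r w y) (thetaC r w y) * uC r w y k) x = 0 :=
    fun k => integral_pD_eq_zero_of_lipschitz (hKA k) k
  have h0E : ∀ k, ∫ x, pD k (fun y => g y / thetaC r w y * qkinC r w y k) x = 0 :=
    fun k => integral_pD_eq_zero_of_lipschitz (hKE k) k
  simp only [h0A, h0E, Finset.sum_const_zero, neg_zero, zero_add, add_zero]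

end Regular

end L

/-- **Registered sub-goal `ledgerL_inner`** of stub `stub_ledger` (line `exact-entropy-ledger-three-passivities`):
The weighted free-flight entropy rate of a regular configuration is integrable over the torus. [folklore] -/
theorem ledgerL_inner :
  ∀ {N : ℕ} {σ r c η₁ η₀ : ℝ} {F : ℝ → ℝ}, EosBand η₀ F → η₁ < η₀ → 0 < σ → 0 < r → 0 < c → ∀ (w : Phase N), (∀ x, c ≤ rhoC r w x ∧ rhoC r w x * σ ^ 3 ≤ η₁ ∧ c ≤ thetaC r w x) → ∀ {g : T3 → ℝ}, Literature.Analysis.FunctionSpaces.Torus.IsContDiff 1 g → MeasureTheory.Integrable (fun x => g x * L.dSfl σ r w x) := by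
  intro N σ r c η₁ η₀ F hE hη₁ hσ hr hc w hreg g hg
  exact (L.integral_mul_dSfl hE hη₁ hσ hr hc w hreg hg).1

end Summit.AtomisticToContinuum.HydrodynamicLimit.Theorems.LocalSecondLawLedger

end
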